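import Literature.Probability.RandomPlanarGeometry.HexSAWBrickWallStripFugacityWidthOneSexticLaw
import Literature.Analysis.Complex.SimpleZeroPerturbation
import HarnessLib

/-!
# The dominant root of the two-wall cubic at complex fugacity `y e^{it}`: persistence near `s = μ₁(y,z)²`

Topic `Literature/Probability/RandomPlanarGeometry` (continues `…WidthOneSexticLaw.lean` — `s = μ₁(y,z)²` is the largest root of `s(s − y)(s − z) = yz`,
`s > max(y, z)` — and uses `Literature/Analysis/Complex/SimpleZeroPerturbation.lean` — persistence of a simple zero of `F(ω, μ)`, `μ` real).
Brick B7 of the Berry–Esseen programme (DOOR-ap5-g27): the complex two-term asymptotics of `C_{1,N}(y e^{it}, z)` (`t = θ/(σ√N)` REAL) need a root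
`s(t) ∈ ℂ` of the cubic `ω(ω − y e^{it})(ω − z) = y e^{it} z` close to the real Perron value `s(0) = μ₁²`.

* §1 `twoWallCubic y z ω t = ω(ω − y e^{it})(ω − z) − y z e^{it}` (entire in `ω`, jointly continuous), its derivative in `ω`,
  `twoWallCubic_zero` (`s = μ₁²` is a root at `t = 0`), ★ `deriv_twoWallCubic_zero` (the root is SIMPLE: `∂_ω F(s, 0) = (s−y)(s−z) + s(s−z) + s(s−y) > 0`).
* §2 ★★ `exists_complexPerronRoot` — for every accuracy `θ ∈ (0,1]` and radius `ρ > 0` there are `ρ' ∈ (0, ρ]`, `δ > 0` such that for all real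
  `|t| < δ` the cubic at fugacity `y e^{it}` has a root `s(t)` with `‖s(t) − s‖ ≤ ρ'` and the first-order location
  `‖s(t) − (s − F(s,t)/∂_ωF(s,0))‖ ≤ θ·‖F(s,t)/∂_ωF(s,0)‖` (the tree's `exists_zero_near_simple_zero`).
With `Literature.Analysis.Asymptotics.norm_root_le_of_near` (cofactor gap) and `cubic_charpoly_data` this supplies the `s`, `R` of
`exists_tendsto_parity_of_rec_six` at complex fugacity.

## Sources
N. R. Beaton et al., CMP 326 (2014), arXiv:1109.0358v5 §3.2 Proposition 6 (`μ_T(y,z)`); L. V. Ahlfors, *Complex Analysis* (1979) Ch. 4 §3.3 (zeros under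
perturbation); lane statements; nothing is quoted AS PRINTED.
-/

noncomputable section

open Set Metric Filter Complex
open Literature.Analysis.Complex
open scoped Topology

namespace Literature.Probability.RandomPlanarGeometry.SAW.HexBW

namespace WidthOneYZ

variable {y z : ℝ}

/-! ## §1 The cubic at complex fugacity -/

/-- **The two-wall cubic at fugacity `y e^{it}`**: `F(ω, t) = ω(ω − y e^{it})(ω − z) − y z e^{it}` (`ω ∈ ℂ`, `t ∈ ℝ`); its zeros are the candidates
for the dominant inverse singularity `s` of the strip series at complex bottom fugacity. [cite: BeatonBousquetMelouDeGierDuminilCopinGuttmann2014, §3.2 Proposition 6 (arXiv v5 p. 10; lane object)] -/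
def twoWallCubic (y z : ℝ) (ω : ℂ) (t : ℝ) : ℂ :=
  ω * (ω - (y : ℂ) * cexp ((t : ℂ) * I)) * (ω - (z : ℂ)) - (y : ℂ) * (z : ℂ) * cexp ((t : ℂ) * I)

/-- `F(·, t)` has derivative `(ω − ye^{it})(ω − z) + ω(ω − z) + ω(ω − ye^{it})` in `ω`. [cite: Ahlfors1979, Ch. 4 §3.3 (lane plumbing)] -/
theorem hasDerivAt_twoWallCubic (y z : ℝ) (t : ℝ) (ω : ℂ) :
    HasDerivAt (fun ω => twoWallCubic y z ω t)
      ((ω - (y : ℂ) * cexp ((t : ℂ) * I)) * (ω - (z : ℂ)) + ω * (ω - (z : ℂ)) + ω * (ω - (y : ℂ) * cexp ((t : ℂ) * I))) ω := by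
  unfold twoWallCubic
  have h1 : HasDerivAt (fun ω : ℂ => ω) 1 ω := hasDerivAt_id ω
  have h2 : HasDerivAt (fun ω : ℂ => ω - (y : ℂ) * cexp ((t : ℂ) * I)) 1 ω := h1.sub_const _
  have h3 : HasDerivAt (fun ω : ℂ => ω - (z : ℂ)) 1 ω := h1.sub_const _
  have h := ((h1.mul h2).mul h3).sub_const ((y : ℂ) * (z : ℂ) * cexp ((t : ℂ) * I))
  exact h.congr_deriv (by simp only [Pi.mul_apply]; ring)

/-- `F(·, t)` is differentiable (entire) for each `t`. [cite: Ahlfors1979, Ch. 4 §3.3 (lane plumbing)] -/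
theorem differentiable_twoWallCubic (y z : ℝ) (t : ℝ) : Differentiable ℂ fun ω => twoWallCubic y z ω t :=
  fun ω => (hasDerivAt_twoWallCubic y z t ω).differentiableAt

/-- `(ω, t) ↦ F(ω, t)` is jointly continuous. [cite: Ahlfors1979, Ch. 4 §3.3 (lane plumbing)] -/
theorem continuous_twoWallCubic (y z : ℝ) : Continuous fun q : ℂ × ℝ => twoWallCubic y z q.1 q.2 := by
  unfold twoWallCubic
  have he : Continuous fun q : ℂ × ℝ => cexp (((q.2 : ℝ) : ℂ) * I) :=
    Complex.continuous_exp.comp ((Complex.continuous_ofReal.comp continuous_snd).mul continuous_const)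
  exact ((continuous_fst.mul (continuous_fst.sub (continuous_const.mul he))).mul (continuous_fst.sub continuous_const)).sub
    (continuous_const.mul he)

/-- At `t = 0` the real Perron value `s = μ₁(y,z)²` is a root: `F(s, 0) = s(s − y)(s − z) − yz = 0` (the sextic law).
[cite: BeatonBousquetMelouDeGierDuminilCopinGuttmann2014, §3.2 Proposition 6 (arXiv v5 p. 10)] -/
theorem twoWallCubic_zero (hy : 0 < y) (hz : 0 < z) : twoWallCubic y z ((stripMuY₂ 1 y z ^ 2 : ℝ) : ℂ) 0 = 0 := by
  have h := stripMuY₂_one_sq_poly_eq hy hz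
  have h' : (stripMuY₂ 1 y z ^ 2 : ℝ) * (stripMuY₂ 1 y z ^ 2 - y) * (stripMuY₂ 1 y z ^ 2 - z) - y * z = 0 := by linear_combination h
  unfold twoWallCubic
  simp only [Complex.ofReal_zero, zero_mul, Complex.exp_zero, mul_one]
  exact_mod_cast h'

/-- ★ **The root is simple**: `∂_ω F(s, 0) = (s − y)(s − z) + s(s − z) + s(s − y)`, a POSITIVE real number since `s > max(y, z)`.
[cite: BeatonBousquetMelouDeGierDuminilCopinGuttmann2014, §3.2 Proposition 6 (arXiv v5 p. 10; lane statement)] -/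
theorem deriv_twoWallCubic_zero (hy : 0 < y) (hz : 0 < z) :
    deriv (fun ω => twoWallCubic y z ω 0) ((stripMuY₂ 1 y z ^ 2 : ℝ) : ℂ)
      = (((stripMuY₂ 1 y z ^ 2 - y) * (stripMuY₂ 1 y z ^ 2 - z) + stripMuY₂ 1 y z ^ 2 * (stripMuY₂ 1 y z ^ 2 - z)
          + stripMuY₂ 1 y z ^ 2 * (stripMuY₂ 1 y z ^ 2 - y) : ℝ) : ℂ) ∧
    0 < (stripMuY₂ 1 y z ^ 2 - y) * (stripMuY₂ 1 y z ^ 2 - z) + stripMuY₂ 1 y z ^ 2 * (stripMuY₂ 1 y z ^ 2 - z)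
          + stripMuY₂ 1 y z ^ 2 * (stripMuY₂ 1 y z ^ 2 - y) := by
  obtain ⟨hsy, hsz⟩ := lt_stripMuY₂_one_sq₂ hy hz
  have hs0 : 0 < stripMuY₂ 1 y z ^ 2 := lt_trans hy hsy
  refine ⟨?_, by nlinarith [mul_pos (sub_pos.2 hsy) (sub_pos.2 hsz), mul_pos hs0 (sub_pos.2 hsz), mul_pos hs0 (sub_pos.2 hsy)]⟩
  rw [(hasDerivAt_twoWallCubic y z 0 _).deriv]
  push_cast
  simp only [zero_mul, Complex.exp_zero, mul_one]

/-! ## §2 ★★ Persistence of the Perron root at complex fugacity -/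

/-- ★★ **THE PERRON ROOT PERSISTS AT COMPLEX FUGACITY `y e^{it}`.**  For `y, z > 0`, every accuracy `θ ∈ (0, 1]` and every radius `ρ > 0` there are
`ρ' ∈ (0, ρ]` and `δ > 0` such that for all real `t` with `|t| < δ` the cubic `ω(ω − ye^{it})(ω − z) = yz e^{it}` has a root `s(t) ∈ ℂ` with
`‖s(t) − s‖ ≤ ρ'` (`s = μ₁(y,z)²`) and `‖s(t) − (s − F(s,t)/F_ω(s,0))‖ ≤ θ‖F(s,t)/F_ω(s,0)‖` — the Newton-step location, in particular
`s(t) = s + O(t)`.  (The tree's `exists_zero_near_simple_zero` at the simple zero `(s, 0)`.) [cite: Ahlfors1979, Ch. 4 §3.3 (zeros persist under perturbation; lane statement); BeatonBousquetMelouDeGierDuminilCopinGuttmann2014, §3.2 Proposition 6] -/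
theorem exists_complexPerronRoot (hy : 0 < y) (hz : 0 < z) {θ : ℝ} (hθ : 0 < θ) (hθ1 : θ ≤ 1) {ρ : ℝ} (hρ : 0 < ρ) :
    ∃ ρ' ∈ Ioc 0 ρ, ∃ δ > 0, ∀ t : ℝ, |t| < δ → ∃ s ∈ closedBall (((stripMuY₂ 1 y z ^ 2 : ℝ) : ℂ)) ρ',
      twoWallCubic y z s t = 0 ∧
      ‖s - ((((stripMuY₂ 1 y z ^ 2 : ℝ) : ℂ)) - twoWallCubic y z ((stripMuY₂ 1 y z ^ 2 : ℝ) : ℂ) t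
          / deriv (fun ω => twoWallCubic y z ω 0) ((stripMuY₂ 1 y z ^ 2 : ℝ) : ℂ))‖
        ≤ θ * ‖twoWallCubic y z ((stripMuY₂ 1 y z ^ 2 : ℝ) : ℂ) t / deriv (fun ω => twoWallCubic y z ω 0) ((stripMuY₂ 1 y z ^ 2 : ℝ) : ℂ)‖ := by
  have hc : deriv (fun ω => twoWallCubic y z ω 0) ((stripMuY₂ 1 y z ^ 2 : ℝ) : ℂ) ≠ 0 := by
    obtain ⟨hd, hpos⟩ := deriv_twoWallCubic_zero hy hz
    rw [hd]
    exact_mod_cast hpos.ne'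
  have h := exists_zero_near_simple_zero (F := fun ω t => twoWallCubic y z ω t) (ω₀ := ((stripMuY₂ 1 y z ^ 2 : ℝ) : ℂ)) (μ₀ := 0)
    (ρ₁ := 1) (δ₀ := 1) one_pos one_pos (fun t _ => (differentiable_twoWallCubic y z t).differentiableOn)
    ((continuous_twoWallCubic y z).continuousOn) (twoWallCubic_zero hy hz) hc hθ hθ1 hρ
  obtain ⟨ρ', hρ', δ, hδ, hall⟩ := h
  refine ⟨ρ', hρ', δ, hδ, fun t ht => ?_⟩
  have ht' : |t - 0| < δ := by rwa [sub_zero]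
  exact hall t ht'

end WidthOneYZ

end Literature.Probability.RandomPlanarGeometry.SAW.HexBW

end
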